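import Summits.AtomisticToContinuum.HydrodynamicLimit.Theses.InformationPercolationEngine
import Summits.AtomisticToContinuum.HydrodynamicLimit.Theses.TwoClocks
import Summits.AtomisticToContinuum.HydrodynamicLimit.Theses.LimitCollisionMeasure
import Summits.AtomisticToContinuum.HydrodynamicLimit.Theorems.InformationPercolationEngineKineticClosureBridge
import Summits.AtomisticToContinuum.HydrodynamicLimit.Theorems.InformationPercolationEngineChaosClosesEulerReductionFields
import Summits.AtomisticToContinuum.HydrodynamicLimit.Theorems.InformationPercolationEngineChaosClosesEulerReadoutMeasurable
import Summits.AtomisticToContinuum.HydrodynamicLimit.Theorems.InformationPercolationEngineChaosClosesEulerEnskogTensor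
import Summits.AtomisticToContinuum.HydrodynamicLimit.Theorems.InformationPercolationEngineChaosClosesEulerStressIsotropyF
import HarnessLib

/-!
# Weak stress isotropy in band from pointwise local equilibrium

Helper for the line `Sketch` of the crux `InformationPercolationEngine.ChaosClosesEuler`
(stmt-AtomisticToContinuum-15141), skeleton v11 (`Cruxes/ChaosClosesEuler/Lines/Sketch.lean`), registered stub
`stub_stressIsotropyOfLocalEquilibrium`: `MaxwellianMoments → PointwiseLocalEquilibrium → TwoClocks.EnergyCurrentTails → WeakStressIsotropyInBand` (bodies VERBATIM the skeleton defs).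

PROOF. `η₀ :=` the band of pointwise local equilibrium; `σ₀ :=` the least of the thresholds of pointwise local
equilibrium, of the cubic tails and `1/2`; at fixed `(σ, T, ρ, θ, u, Φ, t)` the estimate in probability is
`ChaosClosesEulerStressIsotropy.weakStressIsotropy_inProbability` (helper F; helpers A–E: cone `ψ`-moments and tails,
the bulk cut-off and the non-bulk bound, the bulk identity from the Maxwellian moments and tracelessness, measure
theory along a good orbit, the pathwise estimate).  The cone fields of the statement are DEFINITIONALLY the tree's
`rhoC`, `momC`, `kinC`, `thetaC`, `uC`, `MpsiC`.

References: lead NOTES `Cruxes/ChaosClosesEuler/NOTES.md` §F3; S. Chapman, T. G. Cowling (1970) §16.4.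
-/

noncomputable section

namespace Summit.AtomisticToContinuum.HydrodynamicLimit.Theorems.ChaosClosesEulerStressIsotropy

open scoped BigOperators Topology Classical MeasureTheory ENNReal InnerProductSpace
open Filter Set MeasureTheory
open Literature.MathematicalPhysics.KineticTheory
open Literature.Analysis.FluidPDE
open Summit.AtomisticToContinuum.HydrodynamicLimit.Theses
open Summit.AtomisticToContinuum.HydrodynamicLimit.Theses.InformationPercolationEngine
open Summit.AtomisticToContinuum.HydrodynamicLimit.Theorems.LocalSecondLawNegative
open Summit.AtomisticToContinuum.HydrodynamicLimit.Theorems.LocalSecondLawLedger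

/-- Registered stub `stub_stressIsotropyOfLocalEquilibrium` of skeleton v11 (line `Sketch`, crux stmt-AtomisticToContinuum-15141): `MaxwellianMoments → PointwiseLocalEquilibrium → TwoClocks.EnergyCurrentTails → WeakStressIsotropyInBand` (bodies VERBATIM the skeleton defs). [folklore] -/
theorem stub_stressIsotropyOfLocalEquilibrium :
    (∀ (ρ θ : ℝ) (u : V3), 0 < ρ → 0 < θ →
      let m : Measure V3 := volume.withDensity (fun v => ENNReal.ofReal (localMaxwellian ρ θ u v))
      IsFiniteMeasure m ∧ Integrable (fun v : V3 => ‖v‖ ^ 2) m ∧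
      (m Set.univ).toReal = ρ ∧ (∀ j : Fin 3, ∫ v, v j ∂m = ρ * u j) ∧
      (∀ j k : Fin 3, ∫ v, v j * v k ∂m = ρ * (u j * u k + if j = k then θ else 0)) ∧
      (∫ v, ‖v‖ ^ 2 ∂m = ρ * (‖u‖ ^ 2 + 3 * θ)) ∧
      (∀ ψ : V3 → ℝ, Continuous ψ → (∃ C : ℝ, ∀ v, |ψ v| ≤ C) →
        Integrable ψ m ∧ ∫ v, ψ v ∂m = ρ * ∫ v, ψ v * localMaxwellian 1 θ u v)) →
    (∃ η₀ : ℝ, 0 < η₀ ∧ ∀ (a₀ θ₀ : T3 → ℝ) (u₀ : T3 → V3), Continuous a₀ → Continuous θ₀ → Continuous u₀ →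
      (∀ x, 0 < a₀ x) → (∀ x, 0 < θ₀ x) → ∃ σ₀ : ℝ, 0 < σ₀ ∧ ∀ σ : ℝ, 0 < σ → σ < σ₀ →
      ∀ (T : ℝ) (ρ θ : ℝ → T3 → ℝ) (u : ℝ → T3 → V3), IsHardSphereEulerSolution σ T ρ u θ →
      ∀ Φ : (N : ℕ) → HardSphereFlow (Torus.geometry (Fin 3)) (hsDiameter σ N) (N + 1),
      TendstoHydroFieldsAt (fun N => localGibbsLaw σ a₀ u₀ θ₀ N (Φ N)) Φ ρ u θ 0 →
      ∀ t ∈ Set.Ico 0 T, ∀ ψ : V3 → ℝ, Continuous ψ → (∃ C : ℝ, ∀ v, |ψ v| ≤ C) →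
      ∀ h : ℝ × V3 × ℝ → ℝ, Continuous h → (∃ C : ℝ, ∀ p, |h p| ≤ C) →
      (∃ ρ₁ θ₁ Θ U : ℝ, 0 < ρ₁ ∧ 0 < θ₁ ∧ ∀ p : ℝ × V3 × ℝ,
        (p.1 ≤ ρ₁ ∨ η₀ ≤ σ ^ 3 * p.1 ∨ p.2.2 ≤ θ₁ ∨ Θ ≤ p.2.2 ∨ U ≤ ‖p.2.1‖) → h p = 0) →
      ∀ η δ : ℝ, 0 < η → 0 < δ → ∃ r₀ : ℝ, 0 < r₀ ∧ ∀ r : ℝ, 0 < r → r < r₀ → ∃ N₀ : ℕ, ∀ N : ℕ, N₀ ≤ N →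
      let bx : T3 → T3 → ℝ := fun y x => 3 / (Real.pi * r ^ 3) * max (1 - Torus.euclidDist y x / r) 0
      let ρm : Config (N + 1) (Fin 3) T3 → T3 → ℝ := fun w x₀ => ∫ q, bx q.1 x₀ ∂(empiricalMeasure w)
      let mm : Config (N + 1) (Fin 3) T3 → T3 → V3 := fun w x₀ => ∫ q, bx q.1 x₀ • q.2 ∂(empiricalMeasure w)
      let em : Config (N + 1) (Fin 3) T3 → T3 → ℝ := fun w x₀ =>
        ∫ q, bx q.1 x₀ * (‖q.2‖ ^ 2 / 2) ∂(empiricalMeasure w)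
      let um : Config (N + 1) (Fin 3) T3 → T3 → V3 := fun w x₀ => (ρm w x₀)⁻¹ • mm w x₀
      let θm : Config (N + 1) (Fin 3) T3 → T3 → ℝ := fun w x₀ =>
        2 / 3 * (em w x₀ / ρm w x₀ - ‖mm w x₀‖ ^ 2 / (2 * ρm w x₀ ^ 2))
      let Mψ : Config (N + 1) (Fin 3) T3 → T3 → ℝ := fun w x₀ => ∫ q, bx q.1 x₀ * ψ q.2 ∂(empiricalMeasure w)
      localGibbsLaw σ a₀ u₀ θ₀ N (Φ N)
        {z | η < ∫ s in Set.Icc 0 t, ∫ x,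
          |h (ρm ((Φ N).flow s z) x, um ((Φ N).flow s z) x, θm ((Φ N).flow s z) x)| *
            |Mψ ((Φ N).flow s z) x - ρm ((Φ N).flow s z) x *
              ∫ v, ψ v * localMaxwellian 1 (θm ((Φ N).flow s z) x) (um ((Φ N).flow s z) x) v|} ≤ ENNReal.ofReal δ) →
    TwoClocks.EnergyCurrentTails →
    ∃ η₀ : ℝ, 0 < η₀ ∧ ∀ (a₀ θ₀ : T3 → ℝ) (u₀ : T3 → V3), Continuous a₀ → Continuous θ₀ → Continuous u₀ →
      (∀ x, 0 < a₀ x) → (∀ x, 0 < θ₀ x) → ∃ σ₀ : ℝ, 0 < σ₀ ∧ ∀ σ : ℝ, 0 < σ → σ < σ₀ →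
      ∀ (T : ℝ) (ρ θ : ℝ → T3 → ℝ) (u : ℝ → T3 → V3), IsHardSphereEulerSolution σ T ρ u θ →
      ∀ Φ : (N : ℕ) → HardSphereFlow (Torus.geometry (Fin 3)) (hsDiameter σ N) (N + 1),
      TendstoHydroFieldsAt (fun N => localGibbsLaw σ a₀ u₀ θ₀ N (Φ N)) Φ ρ u θ 0 →
      ∀ t ∈ Set.Ico 0 T, ∀ a : Fin 3 → Fin 3 → ℝ × T3 → ℝ, (∀ j k, Continuous (a j k)) →
      (∀ p, ∑ j : Fin 3, a j j p = 0) →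
      ∀ g : ℝ → ℝ, Continuous g → (∀ b, η₀ ≤ b → g b = 0) →
      ∀ η δ : ℝ, 0 < η → 0 < δ → ∃ r₀ : ℝ, 0 < r₀ ∧ ∀ r : ℝ, 0 < r → r < r₀ → ∃ N₀ : ℕ, ∀ N : ℕ, N₀ ≤ N →
      let bx : T3 → T3 → ℝ := fun y x => 3 / (Real.pi * r ^ 3) * max (1 - Torus.euclidDist y x / r) 0
      let ρm : Config (N + 1) (Fin 3) T3 → T3 → ℝ := fun w x₀ => ∫ q, bx q.1 x₀ ∂(empiricalMeasure w)
      let mm : Config (N + 1) (Fin 3) T3 → T3 → V3 := fun w x₀ => ∫ q, bx q.1 x₀ • q.2 ∂(empiricalMeasure w)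
      let Pm : Config (N + 1) (Fin 3) T3 → T3 → Fin 3 → Fin 3 → ℝ := fun w x₀ j k =>
        (∫ q, bx q.1 x₀ * (q.2 j * q.2 k) ∂(empiricalMeasure w)) - mm w x₀ j * mm w x₀ k / ρm w x₀
      localGibbsLaw σ a₀ u₀ θ₀ N (Φ N)
        {z | η < |∫ s in Set.Icc 0 t, ∫ x, g (σ ^ 3 * ρm ((Φ N).flow s z) x) *
          ∑ j : Fin 3, ∑ k : Fin 3, a j k (s, x) * Pm ((Φ N).flow s z) x j k|} ≤ ENNReal.ofReal δ := by
  intro hMM hPLE hECT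
  obtain ⟨η₀, hη₀, HP⟩ := hPLE
  refine ⟨η₀, hη₀, fun a₀ θ₀ u₀ ha hθ hu ha0 hθ0 => ?_⟩
  obtain ⟨σP, hσP, HP1⟩ := HP a₀ θ₀ u₀ ha hθ hu ha0 hθ0
  obtain ⟨σE, hσE, HE1⟩ := hECT a₀ θ₀ u₀ ha hθ hu ha0 hθ0
  refine ⟨min σP (min σE (1 / 2)), lt_min hσP (lt_min hσE (by norm_num)),
    fun σ hσ hσlt T ρ θ u hsol Φ htie t ht a hac htr g hgc hg0 η δ hη hδ => ?_⟩
  have hσP' : σ < σP := hσlt.trans_le (min_le_left _ _)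
  have hσE' : σ < σE := hσlt.trans_le ((min_le_right _ _).trans (min_le_left _ _))
  have hσ2 : σ ≤ 1 / 2 := (hσlt.trans_le ((min_le_right _ _).trans (min_le_right _ _))).le
  exact ChaosClosesEulerStressIsotropy.weakStressIsotropy_inProbability hMM hσ hσ2 ha hθ hu ha0 hθ0 Φ ht.1
    (HP1 σ hσ hσP' T ρ θ u hsol Φ htie t ht) (HE1 σ hσ hσE' T ρ θ u hsol Φ htie t ht) a hac htr g hgc hg0 hη hδ


end Summit.AtomisticToContinuum.HydrodynamicLimit.Theorems.ChaosClosesEulerStressIsotropy
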